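import Literature.AlgebraicGeometry.Resolution.SurfaceResolutionReduction
import Literature.AlgebraicGeometry.Resolution.AlterationsSemiStableCodimTwo
import Literature.AlgebraicGeometry.Resolution.NormalCrossingsStrictification
import Literature.AlgebraicGeometry.Resolution.ExcellentRingsFieldProofs
import Literature.AlgebraicGeometry.Resolution.QuasiExcellentSchemes
import HarnessLib

/-!
# Normal surfaces have finitely many singular points; the residual content of
# `CossartJannsenSaito2020`

Topic: `Literature/AlgebraicGeometry/Resolution`. Continuation of
`SurfaceResolutionReduction.lean`, which PROVES that the named fact `CossartJannsenSaito2020`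
(`ArithmeticalThreefolds.lean`; Cossart–Jannsen–Saito 2020, Thm. 1.2, weak form over fields:
`∀ k, ResolutionOverUpToDim k 2`) is equivalent to the resolution of integral normal surfaces of
dimension `2` of finite type over a field (`cossartJannsenSaito2020_iff_normalSurfaces`). This
file PROVES the next classical step of every surface-resolution argument that starts by
normalizing (Zariski 1939, §1; Lipman 1978, §2 "Let `X` be a reduced noetherian scheme of
dimension 2 … blow up the (finitely many) singular points, normalize, …"): **the singular locus
of a normal surface of finite type over a field is a finite set of closed points**, so that the
residual content of the fact is the resolution of normal surfaces with finitely many (isolated,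
closed) singular points. It also records that, the excellence of finitely generated algebras over
a field being discharged meanwhile (`Stacks07QW_field_holds`, `ExcellentRingsFieldProofs.lean`),
the fact now follows from the single named fact `CossartJannsenSaito2020General`
(CJS Thm. 1.2 as printed, `QuasiExcellentSchemes.lean`) ALONE.

## Content (all PROVED, no new definitions, no new named facts)

* `isRegularLocalRing_of_isIntegrallyClosed_of_ringKrullDim_le_one` — a normal Noetherian local
  domain of dimension `≤ 1` is regular (it is a Dedekind domain, i.e. a field or a discrete
  valuation ring; Atiyah–Macdonald Prop. 9.2, Matsumura Thm. 11.2; "normal ⇒ (R₁)", the easy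
  half of Serre's criterion, Matsumura Thm. 23.8).
* `mem_regularLocus_of_ringKrullDim_stalk_le_one`, `mem_regularLocus_of_specializes`,
  `two_le_ringKrullDim_stalk_of_not_mem_regularLocus` — on an integral locally Noetherian
  scheme with integrally closed local rings and `dim X ≤ 2`, points with local ring of
  dimension `≤ 1`, in particular proper generizations, are regular; singular points have local
  rings of dimension `≥ 2`.
* `isClosed_singleton_of_not_mem_regularLocus` — singular points of a normal surface are closed
  points; `compl_regularLocus_eq_singularLocusCodimLE` — `Sing X` is its codimension-`≤ 2` part.
* `finite_compl_regularLocus_of_normal_surface` — **for `X` integral, normal, Noetherian, locally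
  of finite type over a field, `dim X ≤ 2`: `X ∖ Reg X` is finite** (`Reg X` is open — fields are
  J-2, `isOpen_regularLocus_of_locallyOfFiniteType_field` — and a closed set none of whose points
  has a proper generization inside it is finite, `Scheme.finite_singularLocusCodimLE_two`).
* `cossartJannsenSaito2020_of_isolatedSingularities`,
  `cossartJannsenSaito2020_iff_isolatedSingularities` — `CossartJannsenSaito2020` is equivalent
  to: over every field `k`, every integral normal separated `k`-scheme of finite type of
  dimension `2` whose singular locus is a finite non-empty set of closed points has a resolution
  of singularities (if the singular locus is empty the identity is a resolution).
* `CossartJannsenSaito2020General.cossartJannsenSaito2020_holds_of` —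
  `CossartJannsenSaito2020General → CossartJannsenSaito2020` with no further hypothesis.

## Sources

* V. Cossart, U. Jannsen, S. Saito, *Desingularization: Invariants and Strategy*, LNM 2270
  (2020), Thm. 1.2 (p. 5). [CossartJannsenSaito2020]
* J. Lipman, *Desingularization of two-dimensional schemes*, Ann. of Math. 107 (1978) 151–207,
  §2 (the procedure: blow up the finitely many singular points, normalize, repeat).
* O. Zariski, *The reduction of the singularities of an algebraic surface*, Ann. of Math. 40
  (1939) 639–689.
* H. Matsumura, *Commutative Ring Theory*, CUP 1986, Thm. 11.2 (normal Noetherian local domains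
  of dimension one are DVRs), Thm. 23.8 (Serre's criterion). [Matsumura1987]
-/

noncomputable section

open CategoryTheory AlgebraicGeometry TopologicalSpace Topology

namespace Literature.AlgebraicGeometry.Resolution

universe u

/-! ## Dimension bookkeeping in `WithBot ℕ∞` -/

/-- In `WithBot ℕ∞`, `¬ d ≤ 1` forces `2 ≤ d`. [folklore] -/
theorem WithBot.ENat.two_le_of_not_le_one {d : WithBot ℕ∞} (h : ¬ d ≤ 1) : 2 ≤ d := by
  induction d using WithBot.recBotCoe with
  | bot => exact absurd bot_le h
  | coe a =>
    induction a using ENat.recTopCoe with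
    | top => exact_mod_cast le_top
    | coe n =>
      have hn : ¬ n ≤ 1 := fun hn => h (by exact_mod_cast hn)
      have h2 : (2 : ℕ∞) ≤ (n : ℕ∞) := by exact_mod_cast (show 2 ≤ n by omega)
      exact (WithBot.coe_le_coe.mpr h2 : ((2 : ℕ∞) : WithBot ℕ∞) ≤ _)

/-! ## Normal Noetherian local domains of dimension `≤ 1` are regular -/

/-- **A normal Noetherian local domain of Krull dimension `≤ 1` is a regular local ring**: it is
a Dedekind domain (Noetherian, dimension `≤ 1`, integrally closed), whose localizations at primes
— in particular the ring itself — are fields or discrete valuation rings, hence regular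
(Atiyah–Macdonald, Prop. 9.2; Matsumura, Thm. 11.2; the implication "normal ⇒ (R₁)").
[cite: Matsumura1987, Thm. 11.2] -/
theorem isRegularLocalRing_of_isIntegrallyClosed_of_ringKrullDim_le_one (R : Type*) [CommRing R]
    [IsDomain R] [IsLocalRing R] [IsNoetherianRing R] [IsIntegrallyClosed R]
    (h : ringKrullDim R ≤ 1) : IsRegularLocalRing R := by
  haveI : Ring.DimensionLEOne R := Ring.DimensionLEOne.of_ringKrullDim_le_one h
  haveI : IsDedekindRing R := (isDedekindRing_iff R (FractionRing R)).mpr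
    ⟨inferInstance, inferInstance,
      fun hx => (isIntegrallyClosed_iff (FractionRing R)).mp inferInstance hx⟩
  exact IsRegularLocalRing.of_isRegularRing_of_isLocalRing R

/-! ## Regular and singular points of a normal surface -/

variable {X : Scheme.{u}}

/-- On an integral locally Noetherian scheme all of whose local rings are integrally closed, a
point whose local ring has dimension `≤ 1` is a regular point ("normal ⇒ (R₁)").
[cite: Matsumura1987, Thm. 11.2] -/
theorem mem_regularLocus_of_ringKrullDim_stalk_le_one [IsIntegral X] [IsLocallyNoetherian X]
    (hN : ∀ x : X, IsIntegrallyClosed (X.presheaf.stalk x)) {x : X}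
    (hx : ringKrullDim (X.presheaf.stalk x) ≤ 1) : x ∈ Scheme.regularLocus X := by
  haveI := hN x
  exact isRegularLocalRing_of_isIntegrallyClosed_of_ringKrullDim_le_one (X.presheaf.stalk x) hx

/-- **Proper generizations in a normal surface are regular points**: on an integral locally
Noetherian scheme with integrally closed local rings and `dim X ≤ 2`, if `y ⤳ x` and `y ≠ x`
then `y ∈ Reg X` (`dim 𝒪_{X,y} < dim 𝒪_{X,x} ≤ dim X ≤ 2`). [folklore] -/
theorem mem_regularLocus_of_specializes [IsIntegral X] [IsLocallyNoetherian X]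
    (hN : ∀ x : X, IsIntegrallyClosed (X.presheaf.stalk x)) (hdim : topologicalKrullDim X ≤ 2)
    {x y : X} (h : y ⤳ x) (hne : y ≠ x) : y ∈ Scheme.regularLocus X := by
  refine mem_regularLocus_of_ringKrullDim_stalk_le_one hN ?_
  have hlt := ringKrullDim_stalk_lt_of_specializes h hne
  have hx2 : ringKrullDim (X.presheaf.stalk x) ≤ 2 :=
    (ringKrullDim_stalk_le_topologicalKrullDim X x).trans hdim
  rcases le_one_or_eq_two_of_le_two (hlt.le.trans hx2) with h1 | h2
  · exact h1
  · rw [h2] at hlt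
    exact absurd (lt_of_lt_of_le hlt hx2) (lt_irrefl _)

/-- **Singular points of a normal surface have local rings of dimension `≥ 2`**
(`codim (Sing X, X) ≥ 2`). [folklore] -/
theorem two_le_ringKrullDim_stalk_of_not_mem_regularLocus [IsIntegral X] [IsLocallyNoetherian X]
    (hN : ∀ x : X, IsIntegrallyClosed (X.presheaf.stalk x)) {x : X}
    (hx : x ∉ Scheme.regularLocus X) : (2 : WithBot ℕ∞) ≤ ringKrullDim (X.presheaf.stalk x) :=
  WithBot.ENat.two_le_of_not_le_one fun h1 =>
    hx (mem_regularLocus_of_ringKrullDim_stalk_le_one hN h1)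

/-- **Singular points of a normal surface are closed points**: every point of the closure of a
singular point `x` is a specialization of `x`, and a proper one would make `x` regular.
[folklore] -/
theorem isClosed_singleton_of_not_mem_regularLocus [IsIntegral X] [IsLocallyNoetherian X]
    (hN : ∀ x : X, IsIntegrallyClosed (X.presheaf.stalk x)) (hdim : topologicalKrullDim X ≤ 2)
    {x : X} (hx : x ∉ Scheme.regularLocus X) : IsClosed ({x} : Set X) := by
  rw [← closure_subset_iff_isClosed]
  intro z hz
  have hxz : x ⤳ z := specializes_iff_mem_closure.mpr hz
  by_contra hne
  exact hx (mem_regularLocus_of_specializes hN hdim hxz fun h => hne (h ▸ Set.mem_singleton x))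

/-- For a scheme of dimension `≤ 2`, the singular locus `X ∖ Reg X` is its codimension-`≤ 2`
part `Scheme.singularLocusCodimLE X 2`. [folklore] -/
theorem compl_regularLocus_eq_singularLocusCodimLE (hdim : topologicalKrullDim X ≤ 2) :
    (Scheme.regularLocus X)ᶜ = Scheme.singularLocusCodimLE X 2 := by
  ext x
  simp only [Set.mem_compl_iff, Scheme.mem_regularLocus, Scheme.mem_singularLocusCodimLE]
  exact ⟨fun h => ⟨h, (ringKrullDim_stalk_le_topologicalKrullDim X x).trans hdim⟩, fun h => h.1⟩

/-- **The singular locus of a normal surface of finite type over a field is finite**: for `X`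
integral, Noetherian, locally of finite type over a field `k`, with integrally closed local rings
and `dim X ≤ 2`, the set `X ∖ Reg X` is finite. `Reg X` is open (fields are J-2:
`isOpen_regularLocus_of_locallyOfFiniteType_field`), every singular point has a local ring of
dimension `2` and no proper generization inside the closed set `X ∖ Reg X`, so the singular
points are generic points of irreducible components of `X ∖ Reg X`
(`Scheme.finite_singularLocusCodimLE_two`). (Lipman 1978, §2: "the (finitely many) singular
points" of a normal surface.) [folklore] -/
theorem finite_compl_regularLocus_of_normal_surface {k : Type u} [Field k] [IsIntegral X]
    [IsNoetherian X] (f : X ⟶ Spec (.of k)) [LocallyOfFiniteType f]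
    (hN : ∀ x : X, IsIntegrallyClosed (X.presheaf.stalk x)) (hdim : topologicalKrullDim X ≤ 2) :
    (Scheme.regularLocus X)ᶜ.Finite := by
  rw [compl_regularLocus_eq_singularLocusCodimLE hdim]
  exact Scheme.finite_singularLocusCodimLE_two f fun x hx =>
    two_le_ringKrullDim_stalk_of_not_mem_regularLocus hN hx

/-- A scheme with empty singular locus is regular. [folklore] -/
theorem Scheme.isRegular_of_compl_regularLocus_eq_empty (h : (Scheme.regularLocus X)ᶜ = ∅) :
    Scheme.IsRegular X := fun x => by
  by_contra hx
  have : x ∈ (Scheme.regularLocus X)ᶜ := hx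
  rw [h] at this
  exact this

/-! ## The residual content of `CossartJannsenSaito2020` -/

/-- **`CossartJannsenSaito2020` from the resolution of normal surfaces with isolated
singularities**: if, over every field `k`, every integral normal separated `k`-scheme `X` of
finite type of dimension `2` whose singular locus `X ∖ Reg X` is a finite, non-empty set of
closed points has a resolution of singularities, then `CossartJannsenSaito2020` holds. (By
`cossartJannsenSaito2020_of_normalSurfaces` it suffices to resolve normal surfaces; their
singular locus is always a finite set of closed points, and when it is empty the identity is a
resolution.) [folklore] -/
theorem cossartJannsenSaito2020_of_isolatedSingularities
    (h : ∀ (k : Type u) [Field k] (X : Scheme.{u}) (f : X ⟶ Spec (.of k)),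
      IsSeparated f → LocallyOfFiniteType f → QuasiCompact f → IsIntegral X →
        (∀ x : X, IsIntegrallyClosed (X.presheaf.stalk x)) → topologicalKrullDim X = 2 →
          (Scheme.regularLocus X)ᶜ.Finite → (Scheme.regularLocus X)ᶜ.Nonempty →
            (∀ x ∈ (Scheme.regularLocus X)ᶜ, IsClosed ({x} : Set X)) →
              Scheme.HasResolution X) :
    CossartJannsenSaito2020.{u} := by
  refine cossartJannsenSaito2020_of_normalSurfaces fun k _ X f hsep hlft hqc hint hN hdim => ?_
  haveI := hlft; haveI := hqc; haveI := hint
  haveI : IsNoetherian X := Scheme.isNoetherian_of_finiteType_over_field f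
  rcases Set.eq_empty_or_nonempty (Scheme.regularLocus X)ᶜ with h0 | hne
  · exact (Scheme.isRegular_of_compl_regularLocus_eq_empty h0).hasResolution
  · exact h k X f hsep hlft hqc hint hN hdim
      (finite_compl_regularLocus_of_normal_surface f hN hdim.le) hne
      fun x hx => isClosed_singleton_of_not_mem_regularLocus hN hdim.le hx

/-- `CossartJannsenSaito2020` is EQUIVALENT to the resolution of integral normal surfaces of
dimension `2` over every field whose singular locus is a finite non-empty set of closed points
(its residual content in this tree). [folklore] -/
theorem cossartJannsenSaito2020_iff_isolatedSingularities :
    CossartJannsenSaito2020.{u} ↔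
      ∀ (k : Type u) [Field k] (X : Scheme.{u}) (f : X ⟶ Spec (.of k)),
        IsSeparated f → LocallyOfFiniteType f → QuasiCompact f → IsIntegral X →
          (∀ x : X, IsIntegrallyClosed (X.presheaf.stalk x)) → topologicalKrullDim X = 2 →
            (Scheme.regularLocus X)ᶜ.Finite → (Scheme.regularLocus X)ᶜ.Nonempty →
              (∀ x ∈ (Scheme.regularLocus X)ᶜ, IsClosed ({x} : Set X)) →
                Scheme.HasResolution X :=
  ⟨fun h k _ X f hsep hlft hqc hint hN hdim _ _ _ => (h k).normalSurfaces X f hsep hlft hqc hint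
    hN hdim, cossartJannsenSaito2020_of_isolatedSingularities⟩

/-! ## `CossartJannsenSaito2020` from `CossartJannsenSaito2020General` alone -/

/-- **`CossartJannsenSaito2020General` implies `CossartJannsenSaito2020`** with no further
hypothesis: the glue `CossartJannsenSaito2020General.cossartJannsenSaito2020`
(`QuasiExcellentSchemes.lean`) fed with the discharged excellence of finitely generated algebras
over a field (`Stacks07QW_field_holds`, `ExcellentRingsFieldProofs.lean`). The named fact
`CossartJannsenSaito2020` is thus a corollary of the single named fact
`CossartJannsenSaito2020General` (Cossart–Jannsen–Saito 2020, Thm. 1.2 as printed).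
[cite: CossartJannsenSaito2020, Thm. 1.2] -/
theorem CossartJannsenSaito2020General.cossartJannsenSaito2020_holds_of
    (h : CossartJannsenSaito2020General.{u}) : CossartJannsenSaito2020.{u} :=
  h.cossartJannsenSaito2020 Stacks07QW_field_holds

end Literature.AlgebraicGeometry.Resolution

end
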